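import Summits.FinalStateConjecture.FinalStateConjecture.Theorems.NearExtremalKappaCapture.Negative.ExponentMonotonicity

/-!
# `NearExtremalKappaCapture` (crux stmt-FinalStateConjecture-10606, route PhaseMixingCapture):
# truncation traps — the low-exponent corners are false modulo Kerr-family facts
# (negative-side support, cdisprove seat, cycle 2)

A **truncation trap of order `θ`** in the norm `(s, δ)` on the spin range `a₁M ≤ |a| < M`
(`TruncationTrap θ s δ a₁`) is a vacuum datum on the reference slice `Kerr.slice a M` within
distance `Kχ^θ` of the Kerr datum (`χ = 1 − a²/M²`) whose maximal vacuum Cauchy development is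
NOT far-complete, at every near-extremal spin. `captureWith_false_of_truncationTrap`: a trap of
order `θ` refutes every basin exponent `γ < θ` (all `k, p`). The explicit Kerr family supplies
traps on paper by one mechanism — the slice `{t* = 0, r > M}` is cut a margin `r₊ − M = M√χ`
inside the horizon, and a family member whose horizon fails to enclose the edge sphere `{r = M}`
induces data whose MGHD ends on the outgoing null cone of the edge: mass (`θ = 1`, `δ < −1/2`),
translation and tilt (`θ = 1/2`, `δ < 1/2`), boost (`θ = 1/4`); none for `δ ≥ 1/2`. The mass
fork is carried out modulo three precise facts: `truncationTrap_one_of_lighterMembers` (vacuum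
constraints for Kerr–Schild slice data + `LighterMemberDistBound` + `LighterMemberIncomplete` ⇒ a
trap of order 1), whence `captureWith_false_of_lighterMembers` (`γ < 1` is false for `δ < −1/2`,
refuter-rattack ATTACK-10606.md §6 formalised) and `captureWith_zero_false_of_truncationTrap`
(no κ-uniform basin in any trapped norm). Reading for provers: take `δ ≥ 1/2` (all Poincaré
charges pinned, no explicit trap) or pay `γ ≥` the trap order; by `captureWith_mono` either is
free. Everything is `sorry`-free over `ExponentMonotonicity`'s `CaptureWith`/`FarComplete`.

References: Bartnik, CPAM 39 (1986), (1.2) (weighted norms); O'Neill 1995, Ch. 4 (Kerr causal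
structure); Angelopoulos–Kehle–Unger arXiv:2603.10378, Thm 1 (κ-uniform basin of the spherical
model).
-/

noncomputable section

set_option linter.dupNamespace false

namespace Summit.FinalStateConjecture.FinalStateConjecture.Theorems.NearExtremalKappaCapture.Negative

open Literature.Geometry.Lorentzian
open scoped Manifold ContDiff Topology ENNReal
open Set Filter

/-! ## §6  Truncation traps: the low-exponent corners are false modulo Kerr-family facts -/

/-- **A truncation trap of order `θ`** (`TruncationTrap θ s δ a₁`): for every `M > 0` there is `K`
such that at every spin `a₁M ≤ |a| < M` some solution `D` of the vacuum constraints on the slice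
`Kerr.slice a M` lies within `dist_{s,δ} ≤ K χ^θ` of the Kerr datum (`χ = 1 − a²/M²`) and has a
maximal vacuum Cauchy development that is NOT far-complete. The explicit Kerr family supplies such
traps ON PAPER, all by the same mechanism — the reference slice `{t* = 0, r > M}` is cut at
`r = M`, a margin `r₊ − M = M√χ` inside the event horizon of `Kerr(M, a)`, and a member of the
family whose event horizon fails to enclose the edge sphere `{r = M}` induces data whose MGHD ends
on the outgoing null cone of (part of) the edge, so that far ingoing rays leave after bounded
sojourn:
* mass (`θ = 1`, finite distance iff `δ < −1/2`): `Kerr(M − η, a)`, `η > Mχ/2`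
  (`truncationTrap_one_of_lighterMembers` below);
* translation (`θ = 1/2`, finite distance iff `δ < 1/2`: a translate differs by an `r⁻²` dipole):
  `Kerr(M, a)` translated by `d > M√χ` along the axis (polar horizon radius `r₊ = M + M√χ` against
  polar edge radius `M`);
* tilt of the axis (`θ = 1/2`, finite distance iff `δ < 1/2`): the spheroids `{r = const}` are
  `O(1)`-oblate near extremality (`a ≈ M`), so at mid-latitudes a tilt `ϑ ≳ √χ` already pushes the
  horizon across the edge (at the equator only at second order, `ϑ² ≳ √χ`);
* boost (`θ = 1/4`, finite distance iff `δ < −1/2` in the Kerr–Schild gauge, `g_{ti} ∼ H`): the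
  horizon cross-section is Lorentz-contracted at second order, `v² ≳ √χ`.
For `δ ≥ 1/2` every Poincaré charge is pinned by finiteness of the distance and the explicit family
offers no trap at all (consistent with a κ-UNIFORM basin `γ = 0` in such norms, as AKU prove in
the spherical model, arXiv:2603.10378, Thm. 1). -/
def TruncationTrap [Kerr.Facts] [Kerr.SliceFacts] (θ : ℝ) (s : ℕ) (δ a₁ : ℝ) : Prop :=
  ∀ (M : ℝ) (hM : 0 < M), ∃ K : ℝ, ∀ a : ℝ, a₁ * M ≤ |a| → |a| < M →
    ∃ (D : InitialDataSet 𝓘(ℝ, E3) (Kerr.slice a M)) (_ : D.metric.HasLeviCivita),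
      D.IsVacuumConstraintSolution ∧
        InitialDataSet.dataWeightedSobolevEDist s δ D (Kerr.data M a M hM.le) ≤
            ENNReal.ofReal (K * (1 - (a / M) ^ 2) ^ θ) ∧
          ∃ 𝒟 : VacuumCauchyDevelopment D, 𝒟.IsMaximal ∧ ¬ FarComplete 𝒟

/-- Traps are monotone: a trap of order `θ` is a trap of every order `θ' ≤ θ` (`χ^θ ≤ χ^θ'` on
`(0, 1]`), of every weaker norm `s' ≤ s`, `δ' ≤ δ`, and of every smaller spin range. -/
theorem TruncationTrap.mono [Kerr.Facts] [Kerr.SliceFacts] {θ θ' : ℝ} {s s' : ℕ}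
    {δ δ' a₁ a₁' : ℝ} (h : TruncationTrap θ s δ a₁) (hθ : θ' ≤ θ) (hs : s' ≤ s) (hδ : δ' ≤ δ)
    (ha : a₁ ≤ a₁') : TruncationTrap θ' s' δ' a₁' := by
  intro M hM
  obtain ⟨K, hK⟩ := h M hM
  refine ⟨max K 0, fun a ha' haM ↦ ?_⟩
  obtain ⟨D, inst, hvac, hle, 𝒟, hmax, hfar⟩ :=
    hK a ((mul_le_mul_of_nonneg_right ha hM.le).trans ha') haM
  obtain ⟨hx0, hx1⟩ := kappaSq_pos_le_one (show Kerr.IsSubextremal M a from haM)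
  refine ⟨D, inst, hvac, ?_, 𝒟, hmax, hfar⟩
  calc InitialDataSet.dataWeightedSobolevEDist s' δ' D (Kerr.data M a M hM.le)
      ≤ InitialDataSet.dataWeightedSobolevEDist s δ D (Kerr.data M a M hM.le) :=
        dataWeightedSobolevEDist_mono hs hδ _ _
    _ ≤ ENNReal.ofReal (K * (1 - (a / M) ^ 2) ^ θ) := hle
    _ ≤ ENNReal.ofReal (max K 0 * (1 - (a / M) ^ 2) ^ θ') := by
        refine ENNReal.ofReal_le_ofReal ?_
        calc K * (1 - (a / M) ^ 2) ^ θ ≤ max K 0 * (1 - (a / M) ^ 2) ^ θ :=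
              mul_le_mul_of_nonneg_right (le_max_left _ _) (Real.rpow_nonneg hx0.le _)
          _ ≤ max K 0 * (1 - (a / M) ^ 2) ^ θ' :=
              mul_le_mul_of_nonneg_left (Real.rpow_le_rpow_of_exponent_ge hx0 hx1 hθ)
                (le_max_right _ _)

/-- Choice of a near-extremal spin at `M = 1`: for `0 < χ ≤ 1 − a₀²`, `0 ≤ a₀`, the spin
`a = √(1 − χ)` satisfies `a₀ ≤ a < 1` and `1 − a² = χ`. -/
theorem spin_of_kappaSq {χ a₀ : ℝ} (hχ0 : 0 < χ) (ha₀ : 0 ≤ a₀) (hχa : χ ≤ 1 - a₀ ^ 2) :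
    a₀ ≤ √(1 - χ) ∧ √(1 - χ) < 1 ∧ 1 - √(1 - χ) ^ 2 = χ := by
  have h1χ : 0 ≤ 1 - χ := by nlinarith
  have hss : √(1 - χ) ^ 2 = 1 - χ := Real.sq_sqrt h1χ
  refine ⟨?_, ?_, by linarith⟩
  · calc a₀ = √(a₀ ^ 2) := (Real.sqrt_sq ha₀).symm
      _ ≤ √(1 - χ) := Real.sqrt_le_sqrt (by linarith)
  · rw [Real.sqrt_lt' one_pos]
    nlinarith

/-- **A truncation trap of order `θ` refutes every basin exponent `γ < θ`** (all `k, p`): at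
`M = 1`, given the basin constant `c`, take `χ` so small that `K χ^θ < c χ^γ` (`χ^{θ−γ} < c/K`)
and `a = √(1 − χ)`; the trapped datum lies in the basin, so capture would make its maximal
development far-complete — it is not. Consequently a proof of the crux with basin exponent `γ`
must use a norm `(s, δ)` admitting no trap of order `> γ`; by `captureWith_mono` it may raise
`γ` (or `δ`) instead. -/
theorem captureWith_false_of_truncationTrap [Kerr.Facts] [Kerr.SliceFacts] {θ : ℝ} {s : ℕ}
    {δ : ℝ} {k : ℕ} {γ p a₁ : ℝ} (ha₁ : a₁ < 1) (hT : TruncationTrap θ s δ a₁) (hγ : γ < θ) :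
    ¬ CaptureWith s δ k γ p a₁ := by
  intro h
  obtain ⟨c, hc, C, h⟩ := h 1 one_pos
  obtain ⟨K, hK⟩ := hT 1 one_pos
  -- constants
  set K' : ℝ := max K 0 + 1 with hK'
  have hK'pos : 0 < K' := by positivity
  have hKK' : K ≤ K' := by simp [hK']; linarith [le_max_left K 0]
  set a₀ : ℝ := max a₁ 0 with ha₀
  have ha₀0 : 0 ≤ a₀ := le_max_right _ _
  have ha₀1 : a₀ < 1 := max_lt ha₁ one_pos
  have hx₀ : 0 < 1 - a₀ ^ 2 := by nlinarith
  set e : ℝ := θ - γ with he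
  have he0 : 0 < e := by linarith
  set q : ℝ := c / (2 * K') with hq
  have hq0 : 0 < q := by positivity
  set χ₁ : ℝ := q ^ (1 / e) with hχ₁
  have hχ₁0 : 0 < χ₁ := Real.rpow_pos_of_pos hq0 _
  set χ : ℝ := min χ₁ (1 - a₀ ^ 2) with hχdef
  have hχ0 : 0 < χ := lt_min hχ₁0 hx₀
  have hχle : χ ≤ 1 - a₀ ^ 2 := min_le_right _ _
  -- `χ^e ≤ q`, hence `K' χ^θ ≤ (c/2) χ^γ < c χ^γ`
  have hχe : χ ^ e ≤ q := by
    calc χ ^ e ≤ χ₁ ^ e := Real.rpow_le_rpow hχ0.le (min_le_left _ _) he0.le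
      _ = q := by
          rw [hχ₁, ← Real.rpow_mul hq0.le, one_div_mul_cancel he0.ne', Real.rpow_one]
  have hsplit : χ ^ θ = χ ^ e * χ ^ γ := by
    rw [← Real.rpow_add hχ0, he, sub_add_cancel]
  have hχγ0 : 0 < χ ^ γ := Real.rpow_pos_of_pos hχ0 _
  have hχθ0 : 0 ≤ χ ^ θ := Real.rpow_nonneg hχ0.le _
  have hKχ : K' * χ ^ θ < c * χ ^ γ := by
    calc K' * χ ^ θ = (K' * χ ^ e) * χ ^ γ := by rw [hsplit, mul_assoc]
      _ ≤ (K' * q) * χ ^ γ :=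
          mul_le_mul_of_nonneg_right (mul_le_mul_of_nonneg_left hχe hK'pos.le) hχγ0.le
      _ = (c / 2) * χ ^ γ := by rw [hq]; field_simp
      _ < c * χ ^ γ := by nlinarith
  -- the spin and the trapped datum
  obtain ⟨ha₀a, ha1, haχ⟩ := spin_of_kappaSq hχ0 ha₀0 hχle
  set a : ℝ := √(1 - χ) with ha_def
  have ha0 : 0 ≤ a := Real.sqrt_nonneg _
  have habs : |a| = a := abs_of_nonneg ha0
  have ha₁a : a₁ * 1 ≤ |a| := by rw [mul_one, habs]; exact (le_max_left _ _).trans ha₀a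
  have hsub : Kerr.IsSubextremal 1 a := by show |a| < 1; rwa [habs]
  have hχa : 1 - (a / 1) ^ 2 = χ := by rw [div_one]; exact haχ
  obtain ⟨D, inst, hvacD, hle, 𝒟, hmax, hfar⟩ := hK a ha₁a (by rwa [habs])
  haveI := inst
  have hbasin : InitialDataSet.dataWeightedSobolevEDist s δ D (Kerr.data 1 a 1 one_pos.le) <
      ENNReal.ofReal (c * (1 - (a / 1) ^ 2) ^ γ) := by
    refine hle.trans_lt ((ENNReal.ofReal_lt_ofReal_iff (by rw [hχa]; positivity)).mpr ?_)
    rw [hχa]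
    calc K * χ ^ θ ≤ K' * χ ^ θ := mul_le_mul_of_nonneg_right hKK' hχθ0
      _ < c * χ ^ γ := hKχ
  obtain ⟨-, -, -, -, hfar', -, -⟩ := h a ha₁a hsub D hvacD hbasin 𝒟 hmax
  exact hfar hfar'

/-- **H_dist(s, δ, a₁)** — distance of the exterior-truncated lighter members: for every `M > 0`
there is `K` with `dist_{s,δ}(Kerr.data (M − η) a M, Kerr.data M a M) ≤ K η` for all spins
`a₁M ≤ |a| < M` and all `Mχ/2 < η < M − |a|` (`χ = 1 − a²/M²`). TRUE on paper iff `δ < −1/2`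
(Kerr–Schild `h = δ + 2Hℓ⃗⊗ℓ⃗` is affine in the mass at fixed `a`; `‖(1+|y|)^{δ} r^{-1}‖_{L²}`
finite iff `δ < −1/2`; `k` smooth in the mass with `r^{-2}` decay; compact parameter range);
FALSE for `δ ≥ −1/2` (`dist = ⊤`: the mass is pinned by a finite distance). Bartnik, CPAM 39
(1986), (1.2); Cook, Living Rev. Relativ. 3 (2000), §3.2.2. -/
def LighterMemberDistBound [Kerr.Facts] [Kerr.SliceFacts] (s : ℕ) (δ a₁ : ℝ) : Prop :=
  ∀ (M : ℝ) (hM : 0 < M), ∃ K : ℝ, ∀ (a η : ℝ), a₁ * M ≤ |a| → |a| < M →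
    M * (1 - (a / M) ^ 2) / 2 < η → (hη : η < M - |a|) →
      InitialDataSet.dataWeightedSobolevEDist s δ
          (Kerr.data (M - η) a M (by linarith [abs_nonneg a])) (Kerr.data M a M hM.le) ≤
        ENNReal.ofReal (K * η)

/-- **H_inc(a₁)** — the exterior-truncated lighter members have MGHDs that are NOT far-complete:
for `a₁M ≤ |a| < M` and `Mχ/2 < η < M − |a|` the hole `Kerr(M − η, a)` is sub-extremal with
`r₊(M − η, a) < M`, so the slice `{t* = 0, r > M}` lies in its exterior; the MGHD of the induced
data is the interior of the domain of dependence, bounded to the future by the OUTGOING null cone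
of the edge sphere `{t* = 0, r = M}`, which reaches `𝓘⁺`; every far ingoing normalised null ray
ends on it after affine sojourn `≲ (R₀ − M)/2` in `J⁺(B₀)`, `B₀ ⊆ {r ≤ R₀}` — so the sojourn form
of completeness with far origins fails for every `B₀`. (MGHD existence: Choquet-Bruhat–Geroch;
causal structure of the Kerr exterior: O'Neill 1995, Ch. 4.) The Levi-Civita instance of the datum
is an anonymous binder, as in `ExtremalFormationInBasin`. -/
def LighterMemberIncomplete [Kerr.Facts] [Kerr.SliceFacts] (a₁ : ℝ) : Prop :=
  ∀ (M : ℝ) (_ : 0 < M) (a η : ℝ), a₁ * M ≤ |a| → |a| < M →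
    M * (1 - (a / M) ^ 2) / 2 < η → (hη : η < M - |a|) →
      ∃ (_ : (Kerr.data (M - η) a M (by linarith [abs_nonneg a])).metric.HasLeviCivita)
        (𝒟 : VacuumCauchyDevelopment (Kerr.data (M - η) a M (by linarith [abs_nonneg a]))),
        𝒟.IsMaximal ∧ ¬ FarComplete 𝒟

/-- **The window condition is exactly "the lighter hole's horizon lies inside the edge sphere".**
For `0 < M`, `0 < η` and `|a| ≤ M − η` (the lighter hole `Kerr(M − η, a)` is not super-extremal):
`r₊(M − η, a) < M ↔ Mχ/2 < η` (`χ = 1 − a²/M²`). So in the mass window `Mχ/2 < η < M − |a|` the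
reference slice `{t* = 0, r > M}` lies in the EXTERIOR of `Kerr(M − η, a)` — the geometric premise
of `LighterMemberIncomplete`. [folklore] -/
theorem rPlus_lighter_lt_iff {M a η : ℝ} (hM : 0 < M) (hη : 0 < η) (hsub : |a| ≤ M - η) :
    Kerr.rPlus (M - η) a < M ↔ M * (1 - (a / M) ^ 2) / 2 < η := by
  have hb := abs_nonneg a
  have hma : 0 ≤ (M - η) ^ 2 - a ^ 2 := by nlinarith [sq_abs a]
  have h1 : Kerr.rPlus (M - η) a < M ↔ √((M - η) ^ 2 - a ^ 2) < η := by
    unfold Kerr.rPlus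
    constructor <;> intro h <;> linarith
  have key : M * (1 - (a / M) ^ 2) / 2 = (M ^ 2 - a ^ 2) / (2 * M) := by
    field_simp
  rw [h1, Real.sqrt_lt' hη, key, div_lt_iff₀ (by positivity)]
  constructor <;> intro h <;> nlinarith

/-- The mass window is non-empty and of size `O(χ)`: for `|a| < M`, `0 < M`,
`Mχ/2 < M − |a| ≤ Mχ` (`χ = 1 − a²/M²`; indeed `Mχ = (M − |a|)(M + |a|)/M`). -/
theorem massWindow {M a : ℝ} (hM : 0 < M) (haM : |a| < M) :
    M * (1 - (a / M) ^ 2) / 2 < M - |a| ∧ M - |a| ≤ M * (1 - (a / M) ^ 2) := by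
  have hb := abs_nonneg a
  have key : M * (1 - (a / M) ^ 2) = (M - |a|) * (M + |a|) / M := by
    rw [div_pow, ← sq_abs a]
    field_simp
    ring
  rw [key]
  constructor
  · rw [div_div, div_lt_iff₀ (by positivity)]
    nlinarith [mul_pos (sub_pos.2 haM) (sub_pos.2 haM)]
  · rw [le_div_iff₀ hM]
    nlinarith [mul_nonneg (sub_pos.2 haM).le hb]

/-- **The lighter members are a truncation trap of order `1`.** Granted the vacuum constraints for
Kerr–Schild slice data (named fact `Kerr.data_isVacuumConstraintSolution`, a theorem in the tree
for `a = 0` only), `H_dist(s, δ, a₁)` and `H_inc(a₁)`, the member `Kerr.data (M − η) a M` with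
`η` the midpoint of the mass window is a vacuum datum at distance `≤ Kη ≤ max K 0 · M · χ` whose
MGHD is not far-complete. -/
theorem truncationTrap_one_of_lighterMembers [Kerr.Facts] [Kerr.SliceFacts] {s : ℕ} {δ a₁ : ℝ}
    (hvac : ∀ m a r₀ : ℝ, Kerr.data_isVacuumConstraintSolution m a r₀)
    (hdist : LighterMemberDistBound s δ a₁) (hinc : LighterMemberIncomplete a₁) :
    TruncationTrap 1 s δ a₁ := by
  intro M hM
  obtain ⟨K, hK⟩ := hdist M hM
  refine ⟨max K 0 * M, fun a ha haM ↦ ?_⟩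
  obtain ⟨hw1, hw2⟩ := massWindow hM haM
  set η : ℝ := (M * (1 - (a / M) ^ 2) / 2 + (M - |a|)) / 2 with hη_def
  have hη1 : M * (1 - (a / M) ^ 2) / 2 < η := by rw [hη_def]; linarith
  have hη2 : η < M - |a| := by rw [hη_def]; linarith
  have hη0 : 0 ≤ η := by
    have : 0 < M * (1 - (a / M) ^ 2) / 2 := by
      obtain ⟨hx0, -⟩ := kappaSq_pos_le_one (show Kerr.IsSubextremal M a from haM)
      positivity
    linarith
  have hpos : 0 ≤ M - η := by linarith [abs_nonneg a]
  obtain ⟨inst, 𝒟, hmax, hfar⟩ := hinc M hM a η ha haM hη1 hη2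
  haveI := inst
  refine ⟨Kerr.data (M - η) a M hpos, inst, hvac (M - η) a M hpos, ?_, 𝒟, hmax, hfar⟩
  refine (hK a η ha haM hη1 hη2).trans (ENNReal.ofReal_le_ofReal ?_)
  rw [Real.rpow_one]
  calc K * η ≤ max K 0 * η := mul_le_mul_of_nonneg_right (le_max_left _ _) hη0
    _ ≤ max K 0 * (M * (1 - (a / M) ^ 2)) :=
        mul_le_mul_of_nonneg_left (hη2.le.trans hw2) (le_max_right _ _)
    _ = max K 0 * M * (1 - (a / M) ^ 2) := by ring

/-- **The low-exponent corner `γ < 1` is false modulo three Kerr facts** (mass fork): granted the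
vacuum constraints for Kerr–Schild slice data, `H_dist(s, δ, a₁)` (true iff `δ < −1/2`) and
`H_inc(a₁)`, capture with basin exponent `γ < 1` FAILS for all `k, p`. Hence every proof of the
crux uses `γ ≥ 1` or a norm `δ ≥ −1/2` in which these members are at infinite distance
(refuter-rattack ATTACK-10606.md §6, 2026-08-15, formalised). The translation fork (order `1/2`,
`δ < 1/2`) is the same theorem with `TruncationTrap (1/2)` as hypothesis. -/
theorem captureWith_false_of_lighterMembers [Kerr.Facts] [Kerr.SliceFacts] {s : ℕ} {δ : ℝ}
    {k : ℕ} {γ p a₁ : ℝ} (ha₁ : a₁ < 1)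
    (hvac : ∀ m a r₀ : ℝ, Kerr.data_isVacuumConstraintSolution m a r₀)
    (hdist : LighterMemberDistBound s δ a₁) (hinc : LighterMemberIncomplete a₁) (hγ : γ < 1) :
    ¬ CaptureWith s δ k γ p a₁ :=
  captureWith_false_of_truncationTrap ha₁ (truncationTrap_one_of_lighterMembers hvac hdist hinc) hγ

/-- In particular the κ-UNIFORM basin `γ = 0` that AKU prove in spherical symmetry
(arXiv:2603.10378, Thm 1) is NOT available in any norm admitting a trap of positive order — e.g.
`δ < 1/2` on paper (translation fork), `δ < −1/2` modulo the three facts above (mass fork) — for the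
trivial reason of slice truncation (Angelopoulos–Kehle–Unger arXiv:2603.10378, Thm. 1). -/
theorem captureWith_zero_false_of_truncationTrap [Kerr.Facts] [Kerr.SliceFacts] {θ : ℝ} {s : ℕ}
    {δ : ℝ} {k : ℕ} {p a₁ : ℝ} (ha₁ : a₁ < 1) (hT : TruncationTrap θ s δ a₁) (hθ : 0 < θ) :
    ¬ CaptureWith s δ k 0 p a₁ :=
  captureWith_false_of_truncationTrap ha₁ hT hθ

end Summit.FinalStateConjecture.FinalStateConjecture.Theorems.NearExtremalKappaCapture.Negative

end
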